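import Summits.BirchSwinnertonDyer.BirchSwinnertonDyer.Theorems.EisensteinPrimesTwoVariableCyclotomicUnitLine
import HarnessLib

set_option linter.dupNamespace false
set_option autoImplicit false

/-!
# Crux `CycTangentCM.CycTangentBound` (stmt-BirchSwinnertonDyer-22628), line `tangent-cone-parity`,
# stub `stub_frameSign`: EVALUATION POINTS NEAR THE BOUNDARY — `p`-power roots of unity `ζ` are
# `1`-units with `‖ζ − 1‖^{(p−1)p^{N−1}} = ‖p‖`, hence `‖ζ − 1‖ → 1` (all PROVED)

Route `CycTangentCM` (D-0145 line of ideator bsd-idea-2; K6 leaf `BSDpOnClassX9`); seat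
`bsd-line-ctcm-p2`.  The arithmetic owed by `stub_frameSign` (normal form «odd tangency», file
`CycTangentCMCycTangentBoundFrameSignNormalForm`) is read off the two-variable functional equation
POINTWISE, at points `P(r) = (r(γ₁) − 1, r(γ₂) − 1)` of finite-order characters `r` (file
`CycTangentCMCycTangentBoundFrameSignCharacters`): the residual coefficients `c̄₀₀, c̄₀₁, c̄₁₀` of
`G ∈ 𝒪_{ℂ_p}⟦T₁⟧⟦T₂⟧` and the order of the reduced cyclotomic line are visible in the VALUES of `G`
only at points of norm larger than the (unknown, `< 1`) norms of the non-unit coefficients involved —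
so one needs `1`-units of finite order with `‖u − 1‖` ARBITRARILY CLOSE TO `1`.  This file supplies
them over any ultrametric normed field `F` with `‖p‖ < 1`, `p ≠ 0` (`ℚ̄_p`, `ℂ_p`):

* §1 `norm_pow_sub_one_le` (`‖u^m − 1‖ ≤ ‖u − 1‖` for `‖u‖ ≤ 1`), the binomial identity
  `(1+y)^p = 1 + p y + M₂(y) + y^p` with `‖M₂(y)‖ ≤ ‖p‖‖y‖²` (`norm_binomMiddle_le`);
* §2 `norm_sub_one_lt_one_of_pow_prime_pow_eq_one` (`ζ^{p^N} = 1 ⟹ ‖ζ − 1‖ < 1`),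
  `norm_sub_one_pow_eq_of_prime` (`ζ^p = 1 ≠ ζ ⟹ ‖ζ−1‖^{p−1} = ‖p‖`),
  `norm_sub_one_pow_eq_of_prime_pow` (`ζ^{p^N} = 1 ≠ ζ^{p^{N−1}} ⟹ ‖ζ−1‖^{(p−1)p^{N−1}} = ‖p‖`);
* §3 `exists_rootOfUnity_norm_sub_one_gt` — in `ℚ̄_p`: for every `M < 1` there are `N` and a
  `p^N`-th root of unity `ζ ∈ ℚ̄_pˣ` with `M < ‖ζ − 1‖ < 1` (read in `ℂ_p`), every power of which
  satisfies `‖ζ^m − 1‖ ≤ ‖ζ − 1‖`.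

THEOREMS ONLY (no definition, no named fact, no `sorry`); elementary.  Supports, does not close,
stmt-BirchSwinnertonDyer-22628.

References: [Gouvea1993PadicNumbers] §5.6–§5.7 (roots of unity in `ℚ_p(ζ)`, `|ζ − 1| = p^{−1/φ(p^N)}`);
[Washington1997] Lemma 14.? / §14.1 (`v_p(ζ_{p^n} − 1) = 1/φ(p^n)`); [deShalit1987] II.6.4 proof p. 85
("twist `ε_G` by any character of finite order … enough admissible `ε_G` to separate points").
-/

noncomputable section

open scoped Classical
open Finset

namespace Summit.BirchSwinnertonDyer.BirchSwinnertonDyer.Theorems.CycTangentCMCycTangentBoundFrameSignRoots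

/-! ## §1 One-units and the binomial identity -/

section General

variable {F : Type*} [NormedField F] [IsUltrametricDist F]

/-- `‖u^m − 1‖ ≤ ‖u − 1‖` for `‖u‖ ≤ 1` (`u^m − 1 = (u − 1)(1 + u + ⋯ + u^{m−1})`). [folklore] -/
theorem norm_pow_sub_one_le {u : F} (hu : ‖u‖ ≤ 1) (m : ℕ) : ‖u ^ m - 1‖ ≤ ‖u - 1‖ := by
  have h : u ^ m - 1 = (u - 1) * ∑ i ∈ range m, u ^ i := by
    rw [mul_comm, geom_sum_mul]
  rw [h, norm_mul]
  refine mul_le_of_le_one_right (norm_nonneg _) ?_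
  exact IsUltrametricDist.norm_sum_le_of_forall_le_of_nonneg zero_le_one fun i _ => by
    rw [norm_pow]; exact pow_le_one₀ (norm_nonneg _) hu

omit [IsUltrametricDist F] in
/-- A root of unity has norm `1`. [folklore] -/
theorem norm_eq_one_of_pow_eq_one {u : F} {n : ℕ} (hn : n ≠ 0) (h : u ^ n = 1) : ‖u‖ = 1 := by
  have h1 : ‖u‖ ^ n = 1 := by rw [← norm_pow, h, norm_one]
  exact (pow_eq_one_iff_of_nonneg (norm_nonneg _) hn).mp h1

/-- `‖u − 1‖ ≤ 1` when `‖u‖ ≤ 1`. [folklore] -/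
theorem norm_sub_one_le_one {u : F} (hu : ‖u‖ ≤ 1) : ‖u - 1‖ ≤ 1 := by
  rw [sub_eq_add_neg]
  exact (IsUltrametricDist.norm_add_le_max u (-1)).trans (max_le hu (by rw [norm_neg, norm_one]))

variable (p : ℕ) [hp : Fact p.Prime]

/-- `‖C(p, k)‖ ≤ ‖p‖` for `0 < k < p` (`p ∣ C(p,k)`). [folklore] -/
theorem norm_choose_le {k : ℕ} (hk0 : k ≠ 0) (hkp : k < p) :
    ‖((p.choose k : ℕ) : F)‖ ≤ ‖(p : F)‖ := by
  obtain ⟨m, hm⟩ := hp.out.dvd_choose_self hk0 hkp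
  rw [hm, Nat.cast_mul, norm_mul]
  exact mul_le_of_le_one_right (norm_nonneg _) (IsUltrametricDist.norm_natCast_le_one F m)

omit [IsUltrametricDist F] in
/-- **The binomial identity with the middle terms isolated**:
`(1 + y)^p = 1 + p·y + M₂(y) + y^p`, `M₂(y) = ∑_{2 ≤ k ≤ p−1} C(p,k) y^k`. [folklore] -/
theorem one_add_pow_prime_eq (y : F) :
    (1 + y) ^ p = 1 + (p : F) * y +
      (∑ i ∈ range (p - 2), ((p.choose (i + 2) : ℕ) : F) * y ^ (i + 2)) + y ^ p := by
  obtain ⟨q, rfl⟩ : ∃ q, p = q + 2 := ⟨p - 2, by have := hp.out.two_le; omega⟩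
  have key : (1 + y) ^ (q + 2) = ∑ k ∈ range (q + 2 + 1), (((q + 2).choose k : ℕ) : F) * y ^ k := by
    rw [add_comm (1 : F) y, add_pow]
    exact Finset.sum_congr rfl fun k _ => by rw [one_pow, mul_one, mul_comm]
  rw [key, Finset.sum_range_succ, Finset.sum_range_succ', Finset.sum_range_succ']
  simp only [Nat.choose_self, Nat.choose_zero_right, zero_add, Nat.choose_one_right, Nat.cast_one,
    one_mul, pow_zero, pow_one, Nat.add_sub_cancel, Nat.cast_add, Nat.cast_ofNat]
  ring

/-- The middle binomial terms are small: `‖M₂(y)‖ ≤ ‖p‖·‖y‖²` for `‖y‖ ≤ 1`. [folklore] -/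
theorem norm_binomMiddle_le {y : F} (hy : ‖y‖ ≤ 1) :
    ‖∑ i ∈ range (p - 2), ((p.choose (i + 2) : ℕ) : F) * y ^ (i + 2)‖ ≤ ‖(p : F)‖ * ‖y‖ ^ 2 := by
  refine IsUltrametricDist.norm_sum_le_of_forall_le_of_nonneg (by positivity) fun i hi => ?_
  rw [Finset.mem_range] at hi
  rw [norm_mul, norm_pow, pow_add]
  calc ‖((p.choose (i + 2) : ℕ) : F)‖ * (‖y‖ ^ i * ‖y‖ ^ 2)
      ≤ ‖(p : F)‖ * (1 * ‖y‖ ^ 2) := by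
        refine mul_le_mul (norm_choose_le p (by omega) (by omega)) ?_ (by positivity) (norm_nonneg _)
        exact mul_le_mul_of_nonneg_right (pow_le_one₀ (norm_nonneg _) hy) (by positivity)
    _ = ‖(p : F)‖ * ‖y‖ ^ 2 := by rw [one_mul]

/-- `(1+y)^p − 1 = y^p + R(y)` with `‖R(y)‖ ≤ ‖p‖·‖y‖` for `‖y‖ ≤ 1` (`R = p y + M₂`). [folklore] -/
theorem exists_one_add_pow_prime_sub_one_eq {y : F} (hy : ‖y‖ ≤ 1) :
    ∃ R : F, (1 + y) ^ p - 1 = y ^ p + R ∧ ‖R‖ ≤ ‖(p : F)‖ * ‖y‖ := by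
  refine ⟨(p : F) * y + ∑ i ∈ range (p - 2), ((p.choose (i + 2) : ℕ) : F) * y ^ (i + 2), ?_, ?_⟩
  · rw [one_add_pow_prime_eq p y]; ring
  · refine (IsUltrametricDist.norm_add_le_max _ _).trans (max_le (by rw [norm_mul]) ?_)
    calc _ ≤ ‖(p : F)‖ * ‖y‖ ^ 2 := norm_binomMiddle_le p hy
      _ ≤ ‖(p : F)‖ * ‖y‖ := by
        refine mul_le_mul_of_nonneg_left ?_ (norm_nonneg _)
        rw [sq]; exact mul_le_of_le_one_left (norm_nonneg _) hy

/-! ## §2 Norms of `ζ − 1` for `p`-power roots of unity -/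

/-- If `‖y‖ = 1` then `‖(1+y)^p − 1‖ = 1` (`‖p‖ < 1`): the `p`-th power map preserves distance `1`
from `1`. [folklore] -/
theorem norm_one_add_pow_prime_sub_one_eq_one (hp1 : ‖(p : F)‖ < 1) {y : F} (hy : ‖y‖ = 1) :
    ‖(1 + y) ^ p - 1‖ = 1 := by
  obtain ⟨R, hR, hRn⟩ := exists_one_add_pow_prime_sub_one_eq p hy.le
  have hRlt : ‖R‖ < ‖y ^ p‖ := by
    rw [norm_pow, hy, one_pow]
    exact hRn.trans_lt (by rw [hy, mul_one]; exact hp1)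
  rw [hR, IsUltrametricDist.norm_add_eq_max_of_norm_ne_norm hRlt.ne', max_eq_left hRlt.le, norm_pow,
    hy, one_pow]

/-- **`p`-power roots of unity are `1`-units**: `ζ^{p^N} = 1 ⟹ ‖ζ − 1‖ < 1` (`‖p‖ < 1`). [folklore] -/
theorem norm_sub_one_lt_one_of_pow_prime_pow_eq_one (hp1 : ‖(p : F)‖ < 1) {N : ℕ} {ζ : F}
    (hζ : ζ ^ p ^ N = 1) : ‖ζ - 1‖ < 1 := by
  have hle : ‖ζ - 1‖ ≤ 1 :=
    norm_sub_one_le_one (norm_eq_one_of_pow_eq_one (pow_ne_zero _ hp.out.ne_zero) hζ).le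
  rcases hle.lt_or_eq with h | h
  · exact h
  · exfalso
    -- `‖ζ^{p^j} − 1‖ = 1` for all `j`, contradicting `ζ^{p^N} = 1`
    have key : ∀ j : ℕ, ‖ζ ^ p ^ j - 1‖ = 1 := by
      intro j
      induction j with
      | zero => simpa using h
      | succ j ih =>
        have e : ζ ^ p ^ (j + 1) = (1 + (ζ ^ p ^ j - 1)) ^ p := by
          rw [add_sub_cancel, pow_succ, pow_mul]
        rw [e]
        exact norm_one_add_pow_prime_sub_one_eq_one p hp1 ih
    have := key N
    rw [hζ, sub_self, norm_zero] at this
    exact zero_ne_one this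

/-- **`‖ξ − 1‖^{p−1} = ‖p‖` for a primitive `p`-th root of unity** (`ξ^p = 1`, `ξ ≠ 1`; `‖p‖ < 1`,
`p ≠ 0` in `F`): from `0 = (1+y)^p − 1 = y^p + p y + M₂(y)`, `‖M₂‖ ≤ ‖p‖‖y‖² < ‖p y‖`.
[cite: Gouvea1993PadicNumbers, §5.7 (roots of unity)] -/
theorem norm_sub_one_pow_eq_of_prime (hp1 : ‖(p : F)‖ < 1) (hp0 : (p : F) ≠ 0) {ξ : F}
    (hξ : ξ ^ p = 1) (hξ1 : ξ ≠ 1) : ‖ξ - 1‖ ^ (p - 1) = ‖(p : F)‖ := by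
  have hy0 : ξ - 1 ≠ 0 := sub_ne_zero.mpr hξ1
  have hylt : ‖ξ - 1‖ < 1 :=
    norm_sub_one_lt_one_of_pow_prime_pow_eq_one p hp1 (N := 1) (by rw [pow_one]; exact hξ)
  -- `(ξ-1)^p = −(p (ξ-1) + M₂)`
  have hid : (ξ - 1) ^ p = -((p : F) * (ξ - 1) +
      ∑ i ∈ range (p - 2), ((p.choose (i + 2) : ℕ) : F) * (ξ - 1) ^ (i + 2)) := by
    have e := one_add_pow_prime_eq p (ξ - 1)
    rw [add_sub_cancel, hξ] at e
    linear_combination -e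
  have hM₂lt : ‖∑ i ∈ range (p - 2), ((p.choose (i + 2) : ℕ) : F) * (ξ - 1) ^ (i + 2)‖ <
      ‖(p : F) * (ξ - 1)‖ := by
    refine (norm_binomMiddle_le p hylt.le).trans_lt ?_
    rw [norm_mul, sq, ← mul_assoc]
    exact mul_lt_of_lt_one_right (mul_pos (norm_pos_iff.mpr hp0) (norm_pos_iff.mpr hy0)) hylt
  have hnorm : ‖ξ - 1‖ ^ p = ‖(p : F)‖ * ‖ξ - 1‖ := by
    rw [← norm_pow, hid, norm_neg, IsUltrametricDist.norm_add_eq_max_of_norm_ne_norm hM₂lt.ne',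
      max_eq_left hM₂lt.le, norm_mul]
  have hsplit : ‖ξ - 1‖ ^ p = ‖ξ - 1‖ ^ (p - 1) * ‖ξ - 1‖ := by
    rw [← pow_succ, Nat.sub_add_cancel hp.out.one_lt.le]
  rw [hsplit] at hnorm
  exact mul_right_cancel₀ (norm_ne_zero_iff.mpr hy0) hnorm

/-- **`‖ζ − 1‖^{(p−1)p^{N−1}} = ‖p‖` for a primitive `p^N`-th root of unity** (`N ≥ 1`,
`ζ^{p^N} = 1`, `ζ^{p^{N−1}} ≠ 1`): induction on `N`, the step being `‖ζ − 1‖^p = ‖ζ^p − 1‖`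
(`ζ^p − 1 = (ζ−1)^p + R`, `‖R‖ ≤ ‖p‖‖ζ−1‖ < ‖p‖ ≤ ‖ζ^p − 1‖`).  Hence `‖ζ − 1‖ = ‖p‖^{1/φ(p^N)} → 1`.
[cite: Gouvea1993PadicNumbers, §5.7 (roots of unity)] [cite: Washington1997, §14.1] -/
theorem norm_sub_one_pow_eq_of_prime_pow (hp1 : ‖(p : F)‖ < 1) (hp0 : (p : F) ≠ 0) :
    ∀ (N : ℕ) {ζ : F}, ζ ^ p ^ (N + 1) = 1 → ζ ^ p ^ N ≠ 1 →
      ‖ζ - 1‖ ^ ((p - 1) * p ^ N) = ‖(p : F)‖ := by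
  intro N
  induction N with
  | zero =>
    intro ζ hζ hζ1
    rw [pow_zero, mul_one]
    rw [zero_add, pow_one] at hζ
    rw [pow_zero, pow_one] at hζ1
    exact norm_sub_one_pow_eq_of_prime p hp1 hp0 hζ hζ1
  | succ N ih =>
    intro ζ hζ hζ1
    -- apply the induction hypothesis to `ζ' = ζ^p`
    have hζ' : (ζ ^ p) ^ p ^ (N + 1) = 1 := by rw [← pow_mul, ← pow_succ', hζ]
    have hζ'1 : (ζ ^ p) ^ p ^ N ≠ 1 := by rw [← pow_mul, ← pow_succ']; exact hζ1
    have hIH := ih hζ' hζ'1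
    -- the step `‖ζ − 1‖^p = ‖ζ^p − 1‖`
    have hle1 : ‖ζ - 1‖ ≤ 1 :=
      norm_sub_one_le_one (norm_eq_one_of_pow_eq_one (pow_ne_zero _ hp.out.ne_zero) hζ).le
    have hlt1 : ‖ζ - 1‖ < 1 := norm_sub_one_lt_one_of_pow_prime_pow_eq_one p hp1 hζ
    obtain ⟨R, hR, hRn⟩ := exists_one_add_pow_prime_sub_one_eq p hle1
    rw [add_sub_cancel] at hR
    -- `‖ζ^p − 1‖ ≥ ‖p‖`
    have hge : ‖(p : F)‖ ≤ ‖ζ ^ p - 1‖ := by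
      refine le_of_not_gt fun hlt => ?_
      have hm : 0 < (p - 1) * p ^ N :=
        Nat.mul_pos (by have := hp.out.one_lt; omega) (pow_pos hp.out.pos N)
      have : ‖ζ ^ p - 1‖ ^ ((p - 1) * p ^ N) < ‖(p : F)‖ := by
        calc ‖ζ ^ p - 1‖ ^ ((p - 1) * p ^ N) ≤ ‖ζ ^ p - 1‖ ^ 1 :=
              pow_le_pow_of_le_one (norm_nonneg _) ((hlt.le).trans hp1.le) hm
          _ < ‖(p : F)‖ := by rw [pow_one]; exact hlt
      exact (lt_irrefl _) (hIH ▸ this)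
    have hRlt : ‖R‖ < ‖ζ ^ p - 1‖ := by
      refine hRn.trans_lt (lt_of_lt_of_le ?_ hge)
      exact mul_lt_of_lt_one_right (norm_pos_iff.mpr hp0) hlt1
    have hstep : ‖ζ - 1‖ ^ p = ‖ζ ^ p - 1‖ := by
      have e : (ζ - 1) ^ p = (ζ ^ p - 1) + (-R) := by rw [hR]; ring
      rw [← norm_pow, e, IsUltrametricDist.norm_add_eq_max_of_norm_ne_norm (by rw [norm_neg]; exact hRlt.ne'),
        norm_neg, max_eq_left hRlt.le]
    rw [pow_succ, ← mul_assoc, mul_comm ((p - 1) * p ^ N) p, pow_mul, hstep, hIH]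

end General

/-! ## §3 `p`-power roots of unity of `ℚ̄_p` with `‖ζ − 1‖` as close to `1` as required -/

section PadicAlgCl

variable {p : ℕ} [hp : Fact p.Prime]

/-- `‖p‖ = p⁻¹ < 1` and `p ≠ 0` in `ℚ̄_p`. [folklore] -/
theorem norm_natCast_prime_padicAlgCl :
    ‖((p : ℕ) : PadicAlgCl p)‖ = (p : ℝ)⁻¹ ∧ ‖((p : ℕ) : PadicAlgCl p)‖ < 1 ∧
      ((p : ℕ) : PadicAlgCl p) ≠ 0 := by
  have hnorm : ‖((p : ℕ) : PadicAlgCl p)‖ = (p : ℝ)⁻¹ := by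
    rw [← map_natCast (algebraMap ℚ_[p] (PadicAlgCl p)) p]
    exact (PadicAlgCl.norm_extends (p := p) (p : ℚ_[p])).trans Padic.norm_p
  refine ⟨hnorm, ?_, ?_⟩
  · rw [hnorm]; exact inv_lt_one_of_one_lt₀ (by exact_mod_cast hp.out.one_lt)
  · rw [← norm_pos_iff, hnorm]; exact inv_pos.mpr (by exact_mod_cast hp.out.pos)

/-- **`p`-power roots of unity of `ℚ̄_p` as close to the boundary as required.**  For every `M < 1`
there are `N` and `ζ ∈ ℚ̄_pˣ` with `ζ^{p^N} = 1` and `M < ‖ζ − 1‖` (read in `ℂ_p`); moreover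
`‖ζ − 1‖ < 1` and `‖ζ^m − 1‖ ≤ ‖ζ − 1‖` for all `m`.  (`‖ζ − 1‖ = ‖p‖^{1/((p−1)p^{N−1})}` for a
primitive `ζ`, and `ℚ̄_p` has primitive `p^N`-th roots of unity for all `N`.)
[cite: Gouvea1993PadicNumbers, §5.7 (roots of unity)] [cite: deShalit1987, II.6.4 proof (p. 85)] -/
theorem exists_rootOfUnity_norm_sub_one_gt (M : ℝ) (hM : M < 1) :
    ∃ (N : ℕ) (ζ : (PadicAlgCl p)ˣ), ζ ^ p ^ N = 1 ∧
      M < ‖(((ζ : PadicAlgCl p)) : ℂ_[p]) - 1‖ ∧ ‖(((ζ : PadicAlgCl p)) : ℂ_[p]) - 1‖ < 1 ∧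
      ∀ m : ℕ, ‖(((ζ : PadicAlgCl p)) : ℂ_[p]) ^ m - 1‖ ≤ ‖(((ζ : PadicAlgCl p)) : ℂ_[p]) - 1‖ := by
  obtain ⟨hnorm, hp1, hp0⟩ := norm_natCast_prime_padicAlgCl (p := p)
  -- choose `n` with `max M 0 ^ n < ‖p‖`, then `N = n + 1`
  have hM0 : max M 0 < 1 := max_lt hM one_pos
  obtain ⟨n, hn⟩ := exists_pow_lt_of_lt_one (norm_pos_iff.mpr hp0) hM0
  haveI : NeZero (p ^ (n + 1)) := ⟨pow_ne_zero _ hp.out.ne_zero⟩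
  obtain ⟨ζ, hζ⟩ := HasEnoughRootsOfUnity.prim (M := PadicAlgCl p) (n := p ^ (n + 1))
  have hζ1 : ζ ^ p ^ (n + 1) = 1 := hζ.pow_eq_one
  have hζne : ζ ^ p ^ n ≠ 1 :=
    hζ.pow_ne_one_of_pos_of_lt (pow_ne_zero _ hp.out.ne_zero)
      (Nat.pow_lt_pow_right hp.out.one_lt (Nat.lt_succ_self n))
  have hkey := norm_sub_one_pow_eq_of_prime_pow p hp1 hp0 n hζ1 hζne
  have hlt : ‖ζ - 1‖ < 1 := norm_sub_one_lt_one_of_pow_prime_pow_eq_one p hp1 hζ1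
  -- `M < ‖ζ − 1‖`: otherwise `‖p‖ = ‖ζ−1‖^m ≤ (max M 0)^m ≤ (max M 0)^n < ‖p‖`
  have hgt : M < ‖ζ - 1‖ := by
    refine lt_of_not_ge fun hle => ?_
    have hle' : ‖ζ - 1‖ ≤ max M 0 := hle.trans (le_max_left _ _)
    have hmn : n ≤ (p - 1) * p ^ n := by
      calc n ≤ p ^ n := (Nat.lt_pow_self hp.out.one_lt).le
        _ = 1 * p ^ n := (one_mul _).symm
        _ ≤ (p - 1) * p ^ n := Nat.mul_le_mul_right _ (by have := hp.out.two_le; omega)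
    have : ‖((p : ℕ) : PadicAlgCl p)‖ < ‖((p : ℕ) : PadicAlgCl p)‖ := by
      calc ‖((p : ℕ) : PadicAlgCl p)‖ = ‖ζ - 1‖ ^ ((p - 1) * p ^ n) := hkey.symm
        _ ≤ (max M 0) ^ ((p - 1) * p ^ n) :=
            pow_le_pow_left₀ (norm_nonneg _) hle' _
        _ ≤ (max M 0) ^ n := pow_le_pow_of_le_one (le_max_right _ _) hM0.le hmn
        _ < _ := hn
    exact lt_irrefl _ this
  have hu : IsUnit ζ := IsUnit.of_pow_eq_one hζ1 (pow_ne_zero _ hp.out.ne_zero)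
  refine ⟨n + 1, hu.unit, ?_, ?_, ?_, fun m => ?_⟩
  · exact Units.ext (by rw [Units.val_pow_eq_pow_val, IsUnit.unit_spec, hζ1, Units.val_one])
  · rw [IsUnit.unit_spec, ← UniformSpace.Completion.coe_one, ← UniformSpace.Completion.coe_sub,
      PadicComplex.norm_extends]
    exact hgt
  · rw [IsUnit.unit_spec, ← UniformSpace.Completion.coe_one, ← UniformSpace.Completion.coe_sub,
      PadicComplex.norm_extends]
    exact hlt
  · have hpow : ((((hu.unit : (PadicAlgCl p)ˣ) : PadicAlgCl p)) : ℂ_[p]) ^ m =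
        (((ζ ^ m : PadicAlgCl p)) : ℂ_[p]) := by
      rw [IsUnit.unit_spec, PadicComplex.coe_eq, PadicComplex.coe_eq, map_pow]
    rw [hpow, IsUnit.unit_spec, ← UniformSpace.Completion.coe_one, ← UniformSpace.Completion.coe_sub,
      ← UniformSpace.Completion.coe_sub, PadicComplex.norm_extends, PadicComplex.norm_extends]
    exact norm_pow_sub_one_le (norm_eq_one_of_pow_eq_one (pow_ne_zero _ hp.out.ne_zero) hζ1).le m

end PadicAlgCl

end Summit.BirchSwinnertonDyer.BirchSwinnertonDyer.Theorems.CycTangentCMCycTangentBoundFrameSignRoots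

end
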